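import Summits.AtomisticToContinuum.Crystallization.Theorems.ChartedZeroExcessLayeredLatticeLiouvilleYZ

/-!
(SPLIT FOR THE 400-LINE CAP by the landing lane, hand-2 g36: this file = part 1 of 2; sequels `…ChartedZeroExcessLayeredLatticeLiouvilleZA` import it in a chain; same namespace, all FQNs unchanged.)
# Part ZA «MetricEnclosure» (lens-2 g75): the loose-ball piece (CM) cut by the KIND OF STAR DATUM — rigid vs soft; the metric part PROVED

Docket `stmt-AtomisticToContinuum-26636` (N = `…Theses.ChartedPlanarOrder.ChartedZeroExcessLayered`), cell decomp-a2c RESIDUAL MODE, lens-2 «structural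
dichotomy (special vs generic)», generation 75.  Imports part YZ (g74, record 74D «CoolShellDichotomy», critic row 1322: (XR♮) ⟸ (SC) ∧ (CM)).  TARGET OF
THIS GENERATION: the GENERIC piece **(CM) `MildCoreFillingP`** of 74D (the loose ball matched to, and filling, the shell's crystal), for which row 1322 asked
«a PROVED kinematic lemma (bounded-depth continuation) plus the counting clause», and the cost side of the matching radius.  0 sorry.

## The lens, applied to the DATA a tame star certifies
A `ϑ`-tame star at `a` (part UC `IsTameStar`: a PROPER rotation `U` and a model map `g` into the chart crystal with `dist (U (p − a)) (g p − g a) ≤ ϑ` on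
`S ∩ B̄(a, 4)`) certifies two KINDS of data about a star member `p`:
* FRAME data — the rotation `U` itself.  Continuing frames along a chain of overlapping stars amplifies the error by `(1 + lever/baseline)` per hop
  (`ε_{t+1} ≈ 3ε_t + 3ϑ`): after two hops the bound is useless.  This is the discrete face of the Korn/John obstruction (rotations are controlled by
  strains only in `L²`/BMO, not in `sup`) and is why «bounded-depth continuation» cannot be proved naively.  GENERIC / soft class — NEVER USED below.
* METRIC data — inter-atomic DISTANCES, which are rotation-FREE: `|dist x p − dist (g x) (g p)| ≤ 2ϑ` for any two members of ONE star (PROVED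
  `abs_dist_sub_le_of_isReadTriple`; `ϑ` for a centre pair, `abs_dist_sub_le_of_isReadTriple_self`).  Two sub-kinds, and THIS is the dichotomy the node
  is built on: the **RIGID datum** (two-sided, one star containing both ends: special) and the **SOFT datum** (a one-sided UPPER bound along a chain of
  `≤ 3` readings along NEAR-collinear ordered sites — the triangle inequality adds slops, collinearity defect and registration, `3ϑ + 2ε₁ + ζ`, with NO
  rigidity and NO frame: generic; PROVED `dist_le_of_isNetChain`, the chain itself being purely metric, `IsNetChain`).
* STRUCTURE THEOREM (PROVED, the «kinematic lemma» of row 1322 (ii)) = **ENCLOSURE TRILATERATION**: an atom `x` with a candidate site `c` is pinned by ONE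
  datum on the axis of its (unknown) displacement `v = x − c`: a SOFT datum BEHIND (`c′ − c` within angle `arccos κ` of `−v`) gives `κ·‖v‖ ≤ η`
  (`mul_dist_le_of_behind`: Cauchy–Schwarz, no second-order term, no lever); a RIGID datum IN FRONT at distance `D ≥ Dm`, with the coarse localisation
  `‖v‖ ≤ D₀ < 2κ·Dm` supplied by a soft datum in a WIDE cone `κ₂` (no frame continuation anywhere), gives `‖v‖·(2κD − D₀) ≤ η·(2D − η)`
  (`mul_dist_le_of_front`; assembled in `dist_le_of_enclosed`, pure metric).  Because the loose ball is ENCLOSED by registered matter, EVERY axis through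
  every loose atom carries one or the other within the budget (behind: soft reach `≤ 3·3.8` or `3.8 + 6.6`; else in front `≤ 6.6`: one midpoint star):
  that exhaustion is the piece (EN).  The Korn constant of the enclosed problem is `1/κ` — direction covering, not depth.  STACKING WORDS (the chart's
  word `w` is free): steep EQUAL-hop site rows exist only where the letters at the hop layers are in arithmetic progression mod 3, so long-period words
  lose them (probe: `ABCACB`, `62/150` axes at the centre) — but a centre hop followed by ONE pair-read hop with the intermediate site tuned in its layer
  coset is near-collinear (defect `≤ ζ = 10⁻²`) in EVERY word; with it the probe covers `150/150` axes on all `334` sampled rows (7 words incl. a twin).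
## The node: (CM)(d) ⟸ (EN) `EnclosureNetP` ∧ (OC) `CoreOccupancyP` (junction `mildCoreFillingP_of_enclosureNet_occupancy`, PROVED)
* **(EN)** (ORDER + DENSITY, purely metric, `ϑp`-robust): every atom `x` of the inner core `coreOf S K r` has a site `c ∈ C` such that for every unit
  `u` EITHER a net chain `IsNetChain (3ϑp + ε₁) ζ ε₁` along `C`-sites from `c` into the `κ`-cone of `u` ends on an `ε₁`-registered atom, OR one star
  reads `x` against an `ε₁`-registered atom at a site in the `κ`-cone of `−u` at distance `≥ Dm` AND a net chain runs into the wide `κ₂`-cone of `u`.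
  INCOMPARABLE with (CM) formally; weaker in kind (no assignment, no injectivity, no occupancy, no `d`: the QUANTITATIVE `d` is produced by the
  junction).  UNDECIDED→TRUE-leaning · INSTRUMENTABLE «Enclosure-T» · ATTACKABLE-M.
* **(OC)** (COUNTING): every site of `C` within `rI` of `K` has an atom of `S` within `d₁`.  STRICTLY WEAKER than (CM) (PROVED
  `coreOccupancyP_of_mildCoreFilling`, `d ≤ d₁`, `rI ≤ ρf`).  TRUE-leaning · ATTACKABLE-S (clean two-shell completeness, induction inward from REG-in).
* JUNCTION: site assembly — existence from (EN) + `dist_le_of_enclosed` on `coreOf S K r`, from REG-out elsewhere (`ε ≤ d`); injectivity from the hard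
  core `27/32` of door sets (`2d < 27/32`, `isSep_of_isDoorSetP`); occupancy from (OC) on deep sites and REG-in on the rest, uniqueness by `σ`-separation
  of `C` (`d + d₁ < σ`).  Dial arithmetic: `ηA = 3ϑp + 2ε₁ + ζ ≤ κd ∧ κ₂D₀`, `D₀ < 2κDm`, `ηB = 2ϑp + 2ε₁ ≤ Dm ∧ κd`, `ηB(2Dm − ηB) ≤ d(2κDm − D₀)`;
  pinned `(ε₁, ζ, κ, κ₂, Dm, D₀, d, d₁) = (10⁻³, 10⁻², 4/5, 1/2, 2, 2/3, 2/5, 2/5)`.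
## Finding (ask (i) of row 1322) — the record matching radius `d = 1/5` is NASH-GUARDED; re-pin `dB = 1/10`
The graded slip `u(x) = e·(R − |x − x₀|)₊·v`, `e = ϑp/4`, keeps every `4`-star `ϑp`-tame, is forced rigid only where cool stars look (`dist(·, K) > 4`), so
for the fat container `K = S ∩ B̄(x₀, 4)` it has depth `R = 8 + gap′` and centre drift `e·R = 1/5 + gap′/40 ≥ d_record` while clean and separated: only
`IsNash` excludes it, i.e. (CM)@`1/5` is docket-strength on the slip axis.  The PROVED bound of this part is `d ≥ (3ϑp + 2ε₁ + ζ)/κ ≥ 3/10` (sharp in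
`η`: `behind_bound_sharp`; `record_pin_infeasible`), so the junction instantiates at `d = 2/5` (`dB = dm − d = 1/10`) and NOT at `1/5` (canary).  Cost side of `dB: 3/10 → 1/10` on the
siblings of 73S: (XR♮)/(X1)/(Gp♮)/(Gs) quantify over a SMALLER tube (easier in content; the reference class `IsTubeReference … dB …` widens — formally
incomparable), (Res) conclusion `dB`-free, (Gl♮) has no `dB`; the genuine cost is the three B-rows — Neumann `Σ_c H_{B,c} κ_c ≤ qN·dB`, weights
`G_{B,c} ≤ w_c·dB`, budget `Σ_c C_{B,c} ε_c ≤ dB₁ < dB` (`3/20 → 1/20`) — already owed to the outer radii `≈ 1/800` (part YS).  Re-pinned instances PROVED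
below down to the docket leaf (`σ: 3/4 → 17/20` rides along: (SC) asked at separation `17/20`, harmless for a fitted crystal of scale `≥ 0.88`, needed for
`d + d₁ < σ` with `d₁ = d`).
Sources: F. John, CPAM 14 (1961) 391–413; Friesecke–James–Müller, CPAM 55 (2002) Thm 3.1 & §4 (Korn/rotation control is `L²`); B. Schmidt, Netw.
Heterog. Media 4 (2009); Conway–Sloane SPLAG ch. 7; GPS/trilateration folklore (dilution of precision = `1/κ`); parts UC, YO, YX, YY, YZ; CRITIC-LEDGER
rows 1237, 1312, 1322. [this file, g75]
-/

noncomputable section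
open scoped BigOperators Classical InnerProductSpace RealInnerProductSpace
open MeasureTheory Set Metric Filter Topology
open Summit.AtomisticToContinuum.Crystallization.Theorems.ChartedPlanarOrderRigidityDoor (E3 IsClean)
open Summit.AtomisticToContinuum.Crystallization.Theorems.ChartedPlanarOrderDensityDichotomy (μS IsSep)
open Summit.AtomisticToContinuum.Crystallization.Theorems.ChartedPlanarOrderCleanScaleP (IsCleanP IsDoorSetP isCleanP_one_iff isCleanP_mono)
open Summit.AtomisticToContinuum.Crystallization.Theorems.ChartedPlanarOrderMesoCut (LayeredHom EnvClose)
open Summit.AtomisticToContinuum.Crystallization.Theorems.ChartedPlanarOrderDoorLayeredOsc (IsTwoShellAffineGood)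
open Literature.MathematicalPhysics.StatisticalMechanics (lennardJones)

namespace Summit.AtomisticToContinuum.Crystallization.Theorems.ChartedZeroExcessLayeredLatticeLiouville

/-! ### ZA-1  Star readings: the RIGID datum and the SOFT datum (PROVED kinematics, rotation-free) -/

section Readings

/-- `IsStarModel ϑ S H a U g`: `(U, g)` witnesses the `ϑ`-tame star of `S` at `a` against `H` — exactly the body of part UC's `IsTameStar`
(`isTameStar_iff_exists_isStarModel`). [this file, g75] -/
def IsStarModel (ϑ : ℝ) (S H : Set E3) (a : E3) (U : E3 ≃ₗᵢ[ℝ] E3) (g : E3 → E3) : Prop :=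
  LinearMap.det (U.toLinearEquiv : E3 →ₗ[ℝ] E3) = 1 ∧ MapsTo g (S ∩ closedBall a 4) H ∧
    ∀ p ∈ S, dist p a ≤ 4 → dist (U (p - a)) (g p - g a) ≤ ϑ

/-- `isTameStar_iff_exists_isStarModel` (docstring added by the landing lane; see the module docstring). [formal bookkeeping] -/
theorem isTameStar_iff_exists_isStarModel {ϑ : ℝ} {S H : Set E3} {a : E3} :
    IsTameStar ϑ S H a ↔ ∃ (U : E3 ≃ₗᵢ[ℝ] E3) (g : E3 → E3), IsStarModel ϑ S H a U g := Iff.rfl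

/-- `IsReadTriple ϑ S H a x p D`: SOME `ϑ`-tame model of the star at `a` READS the pair `(x, p)` of star members at model distance `D`
(`dist (g x) (g p) = D`).  With `a = x` this is a centre reading. [this file, g75] -/
def IsReadTriple (ϑ : ℝ) (S H : Set E3) (a x p : E3) (D : ℝ) : Prop :=
  ∃ (U : E3 ≃ₗᵢ[ℝ] E3) (g : E3 → E3), IsStarModel ϑ S H a U g ∧ x ∈ S ∧ dist x a ≤ 4 ∧ p ∈ S ∧ dist p a ≤ 4 ∧ dist (g x) (g p) = D

/-- one member against the centre: `|dist p a − dist (g p) (g a)| ≤ ϑ` (the rotation drops out of the norm). [this file, g75] -/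
theorem abs_dist_sub_dist_model_le {ϑ : ℝ} {S H : Set E3} {a p : E3} {U : E3 ≃ₗᵢ[ℝ] E3} {g : E3 → E3}
    (hM : IsStarModel ϑ S H a U g) (hp : p ∈ S) (hpa : dist p a ≤ 4) : |dist p a - dist (g p) (g a)| ≤ ϑ := by
  have h := hM.2.2 p hp hpa
  rw [dist_eq_norm] at h
  calc |dist p a - dist (g p) (g a)| = |‖U (p - a)‖ - ‖g p - g a‖| := by rw [U.norm_map, dist_eq_norm, dist_eq_norm]
    _ ≤ ‖U (p - a) - (g p - g a)‖ := abs_norm_sub_norm_le _ _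
    _ ≤ ϑ := h

/-- ★ **THE RIGID DATUM (PROVED)**: a pair read inside ONE `ϑ`-tame star has its distance pinned TWO-SIDEDLY to the model distance, slop `2ϑ` — no frame,
no lever. [this file, g75] -/
theorem abs_dist_sub_le_of_isReadTriple {ϑ : ℝ} {S H : Set E3} {a x p : E3} {D : ℝ} (h : IsReadTriple ϑ S H a x p D) :
    |dist x p - D| ≤ 2 * ϑ := by
  obtain ⟨U, g, hM, hx, hxa, hp, hpa, hD⟩ := h
  have h1 := hM.2.2 x hx hxa
  have h2 := hM.2.2 p hp hpa
  have e1 : dist x p = dist (U (x - a)) (U (p - a)) := by rw [U.dist_map, dist_sub_right]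
  have e2 : D = dist (g x - g a) (g p - g a) := by rw [← hD, dist_sub_right]
  rw [e1, e2]
  calc |dist (U (x - a)) (U (p - a)) - dist (g x - g a) (g p - g a)|
      ≤ |dist (U (x - a)) (U (p - a)) - dist (g x - g a) (U (p - a))| +
          |dist (g x - g a) (U (p - a)) - dist (g x - g a) (g p - g a)| := abs_sub_le _ _ _
    _ ≤ dist (U (x - a)) (g x - g a) + dist (U (p - a)) (g p - g a) := by
        refine add_le_add (abs_dist_sub_le _ _ _) ?_
        rw [dist_comm (g x - g a) (U (p - a)), dist_comm (g x - g a) (g p - g a)]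
        exact abs_dist_sub_le _ _ _
    _ ≤ ϑ + ϑ := add_le_add h1 h2
    _ = 2 * ϑ := by ring

/-- the centre reading: slop `ϑ`. [this file, g75] -/
theorem abs_dist_sub_le_of_isReadTriple_self {ϑ : ℝ} {S H : Set E3} {x p : E3} {D : ℝ} (h : IsReadTriple ϑ S H x x p D) :
    |dist x p - D| ≤ ϑ := by
  obtain ⟨U, g, hM, -, -, hp, hpx, hD⟩ := h
  have := abs_dist_sub_dist_model_le hM hp hpx
  rwa [dist_comm p x, dist_comm (g p) (g x), hD] at this

/-- a reading whose model distance matches a target `D′` up to `τ` (the chart crystal `H` and the shell crystal `C` have `2ϑr`-close, not equal,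
distance sets): centre reading ⇒ net hop of slop `ϑ + τ`. [this file, g75] -/
theorem netHop_of_isReadTriple_self {ϑ τ : ℝ} {S H : Set E3} {x p : E3} {D D' : ℝ} (h : IsReadTriple ϑ S H x x p D) (hτ : |D - D'| ≤ τ) :
    |dist x p - D'| ≤ ϑ + τ :=
  (abs_sub_le _ _ _).trans (add_le_add (abs_dist_sub_le_of_isReadTriple_self h) hτ)

/-- pair reading ⇒ net hop / rigid datum of slop `2ϑ + τ`. [this file, g75] -/
theorem netHop_of_isReadTriple {ϑ τ : ℝ} {S H : Set E3} {a x p : E3} {D D' : ℝ} (h : IsReadTriple ϑ S H a x p D) (hτ : |D - D'| ≤ τ) :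
    |dist x p - D'| ≤ 2 * ϑ + τ :=
  (abs_sub_le _ _ _).trans (add_le_add (abs_dist_sub_le_of_isReadTriple h) hτ)

end Readings

/-! ### ZA-2  Net chains: the SOFT datum is purely metric (PROVED: upper bounds add along near-collinear site chains) -/

section Chains

/-- `IsNetChain η ζ ε₁ S C x c c′`: a SOFT CHAIN from the atom `x` (candidate site `c`) to an `ε₁`-REGISTERED atom at the site `c′ ∈ C`: atoms
`x → x₁ → x₂ → x₃` of `S` and sites `c → c₁ → c₂ → c′` of `C` with TOTAL HOP SLOP `Σ |dist xᵢ₋₁ xᵢ − dist cᵢ₋₁ cᵢ| ≤ η` (three centre readings, or one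
centre + one pair reading: `η = 3ϑ + mismatch`), NEAR-COLLINEAR ORDERED sites (`Σ dist cᵢ₋₁ cᵢ ≤ dist c c′ + ζ`, collinearity defect `ζ`; degenerate hops
`xᵢ = xᵢ₊₁, cᵢ = cᵢ₊₁` allowed) and `dist x₃ c′ ≤ ε₁`.  No star, no frame, no `H`: the readings of ZA-1 are how a prover PRODUCES the hops
(`netHop_of_isReadTriple_self`). [this file, g75] -/
def IsNetChain (η ζ ε₁ : ℝ) (S C : Set E3) (x c c' : E3) : Prop :=
  ∃ x₁ x₂ x₃ c₁ c₂ : E3, x₁ ∈ S ∧ x₂ ∈ S ∧ x₃ ∈ S ∧ c₁ ∈ C ∧ c₂ ∈ C ∧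
    |dist x x₁ - dist c c₁| + |dist x₁ x₂ - dist c₁ c₂| + |dist x₂ x₃ - dist c₂ c'| ≤ η ∧
      dist c c₁ + dist c₁ c₂ + dist c₂ c' ≤ dist c c' + ζ ∧ dist x₃ c' ≤ ε₁

/-- ★ **THE SOFT DATUM (PROVED)**: `dist x c′ ≤ dist c c′ + (η + ζ + ε₁)` — the triangle inequality only; slops, defect and registration ADD (this is
all that «bounded-depth continuation» honestly delivers in `sup`-norm, and it is enough BEHIND a displacement). [this file, g75] -/
theorem dist_le_of_isNetChain {η ζ ε₁ : ℝ} {S C : Set E3} {x c c' : E3} (h : IsNetChain η ζ ε₁ S C x c c') :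
    dist x c' ≤ dist c c' + (η + ζ + ε₁) := by
  obtain ⟨x₁, x₂, x₃, c₁, c₂, -, -, -, -, -, hη, hζ, hanc⟩ := h
  have t₁ := dist_triangle x x₃ c'
  have t₂ := dist_triangle4 x x₁ x₂ x₃
  have a₁ := le_abs_self (dist x x₁ - dist c c₁)
  have a₂ := le_abs_self (dist x₁ x₂ - dist c₁ c₂)
  have a₃ := le_abs_self (dist x₂ x₃ - dist c₂ c')
  linarith

/-- a chain built from three centre readings at model distances `Dᵢ` matching the site distances up to `τ` each, ending on an `ε₁`-registered atom, IS a
net chain of slop `3(ϑ + τ)` (PROVED bridge: tameness ⇒ soft data). [this file, g75] -/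
theorem isNetChain_of_reads {ϑ τ ζ ε₁ : ℝ} {S H C : Set E3} {x x₁ x₂ x₃ c c₁ c₂ c' : E3} {D₁ D₂ D₃ : ℝ}
    (h₁ : IsReadTriple ϑ S H x x x₁ D₁) (h₂ : IsReadTriple ϑ S H x₁ x₁ x₂ D₂) (h₃ : IsReadTriple ϑ S H x₂ x₂ x₃ D₃)
    (hτ₁ : |D₁ - dist c c₁| ≤ τ) (hτ₂ : |D₂ - dist c₁ c₂| ≤ τ) (hτ₃ : |D₃ - dist c₂ c'| ≤ τ) (hx₃ : x₃ ∈ S) (hc₁ : c₁ ∈ C) (hc₂ : c₂ ∈ C)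
    (hcol : dist c c₁ + dist c₁ c₂ + dist c₂ c' ≤ dist c c' + ζ) (hanc : dist x₃ c' ≤ ε₁) :
    IsNetChain (3 * (ϑ + τ)) ζ ε₁ S C x c c' := by
  have hx₁S : x₁ ∈ S := by obtain ⟨_, _, -, h, -⟩ := h₂; exact h
  have hx₂S : x₂ ∈ S := by obtain ⟨_, _, -, h, -⟩ := h₃; exact h
  refine ⟨x₁, x₂, x₃, c₁, c₂, hx₁S, hx₂S, hx₃, hc₁, hc₂, ?_, hcol, hanc⟩
  have e₁ := netHop_of_isReadTriple_self h₁ hτ₁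
  have e₂ := netHop_of_isReadTriple_self h₂ hτ₂
  have e₃ := netHop_of_isReadTriple_self h₃ hτ₃
  linarith

end Chains

/-! ### ZA-3  ENCLOSURE TRILATERATION (PROVED): one datum on the displacement axis pins the atom — constant `1/κ`, no depth factor -/

section Trilateration

/-- ★★ **VERSION A — a SOFT datum BEHIND the displacement (PROVED)**: if the anchor direction `c′ − c` lies within angle `arccos κ` of `c − x` and
`dist x c′ ≤ dist c c′ + η`, then `κ·dist x c ≤ η`.  (Cauchy–Schwarz against the unit vector `−(c′ − c)/‖c′ − c‖`; no second-order term.) [this file, g75] -/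
theorem mul_dist_le_of_behind {x c c' : E3} {κ η : ℝ} (hκ₁ : κ ≤ 1)
    (hdir : κ * ‖c' - c‖ * ‖c - x‖ ≤ ⟪c' - c, c - x⟫_ℝ) (hup : dist x c' ≤ dist c c' + η) : κ * dist x c ≤ η := by
  have hD : dist c c' = ‖c' - c‖ := by rw [dist_comm, dist_eq_norm]
  have hxc : dist x c = ‖c - x‖ := by rw [dist_comm, dist_eq_norm]
  have hxc' : dist x c' = ‖(c' - c) + (c - x)‖ := by rw [dist_comm, dist_eq_norm, sub_add_sub_cancel]
  rw [hD, hxc'] at hup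
  rw [hxc]
  by_cases hw : c' - c = 0
  · have h0 : ‖c - x‖ ≤ η := by simpa [hw] using hup
    calc κ * ‖c - x‖ ≤ 1 * ‖c - x‖ := mul_le_mul_of_nonneg_right hκ₁ (norm_nonneg _)
      _ ≤ η := by rw [one_mul]; exact h0
  · have hwpos : 0 < ‖c' - c‖ := norm_pos_iff.2 hw
    -- Cauchy–Schwarz: ⟪(c′−c) + (c−x), c′−c⟫ ≤ ‖(c′−c)+(c−x)‖·‖c′−c‖
    have hCS := real_inner_le_norm ((c' - c) + (c - x)) (c' - c)
    have hexp : ⟪(c' - c) + (c - x), c' - c⟫_ℝ = ‖c' - c‖ ^ 2 + ⟪c' - c, c - x⟫_ℝ := by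
      rw [inner_add_left, real_inner_self_eq_norm_sq, real_inner_comm]
    rw [hexp] at hCS
    -- ‖c′−c‖² + κ‖c′−c‖‖c−x‖ ≤ ‖c′−c‖ (‖c′−c‖ + η)
    have key : ‖c' - c‖ * (κ * ‖c - x‖) ≤ ‖c' - c‖ * η := by
      nlinarith [mul_le_mul_of_nonneg_right hup hwpos.le, norm_nonneg ((c' - c) + (c - x))]
    exact le_of_mul_le_mul_left key hwpos

/-- ★★ **VERSION B — a RIGID datum IN FRONT of the displacement (PROVED)**: if `c′ − c` lies within angle `arccos κ` of `x − c`, `η ≤ dist c c′`, the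
coarse localisation `dist x c ≤ D₀` holds and `dist c c′ − η ≤ dist x c′`, then `dist x c · (2κ·dist c c′ − D₀) ≤ η·(2·dist c c′ − η)`. [this file, g75] -/
theorem mul_dist_le_of_front {x c c' : E3} {κ η D₀ : ℝ}
    (hdir : κ * ‖c' - c‖ * ‖x - c‖ ≤ ⟪c' - c, x - c⟫_ℝ) (hη : η ≤ dist c c') (hxc : dist x c ≤ D₀)
    (hlow : dist c c' - η ≤ dist x c') : dist x c * (2 * κ * dist c c' - D₀) ≤ η * (2 * dist c c' - η) := by
  have hD : dist c c' = ‖c' - c‖ := by rw [dist_comm, dist_eq_norm]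
  have hv : dist x c = ‖x - c‖ := dist_eq_norm _ _
  have hxc' : dist x c' = ‖(x - c) - (c' - c)‖ := by rw [dist_eq_norm, sub_sub_sub_cancel_right]
  rw [hD] at hη hlow ⊢
  rw [hv] at hxc ⊢
  rw [hxc'] at hlow
  have hsq : ‖(x - c) - (c' - c)‖ ^ 2 = ‖x - c‖ ^ 2 - 2 * ⟪x - c, c' - c⟫_ℝ + ‖c' - c‖ ^ 2 := norm_sub_sq_real _ _
  have hlow2 : (‖c' - c‖ - η) ^ 2 ≤ ‖(x - c) - (c' - c)‖ ^ 2 :=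
    pow_le_pow_left₀ (by linarith) hlow 2
  rw [hsq, real_inner_comm] at hlow2
  nlinarith [mul_le_mul_of_nonneg_right hxc (norm_nonneg (x - c)), norm_nonneg (x - c), norm_nonneg (c' - c)]

/-- ★ **SHARPNESS OF VERSION A (PROVED)**: for every `η ≥ 0` and `D > 0` there are `x, c, c′` with the anchor EXACTLY behind (`κ = 1`),
`dist x c′ = dist c c′ + η` and `dist x c = η` — the constant `1/κ` cannot be improved (the graded slip of the module docstring realises it with atoms).
[this file, g75] -/
theorem behind_bound_sharp {η D : ℝ} (hη : 0 ≤ η) (hD : 0 < D) :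
    ∃ x c c' : E3, 1 * ‖c' - c‖ * ‖c - x‖ ≤ ⟪c' - c, c - x⟫_ℝ ∧ dist x c' = dist c c' + η ∧ dist c c' = D ∧ dist x c = η := by
  obtain ⟨e, he⟩ : ∃ e : E3, ‖e‖ = 1 := exists_norm_eq E3 zero_le_one
  refine ⟨η • e, 0, (-D) • e, ?_, ?_, ?_, ?_⟩
  · rw [sub_zero, zero_sub, ← neg_smul, inner_smul_left, inner_smul_right, real_inner_self_eq_norm_sq, he, norm_smul, norm_neg, norm_smul,
      he, Real.norm_eq_abs, Real.norm_eq_abs, abs_neg, abs_of_pos hD, abs_of_nonneg hη]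
    simp
  · rw [dist_eq_norm, dist_eq_norm, zero_sub, norm_neg, ← sub_smul, norm_smul, norm_smul, he, Real.norm_eq_abs, Real.norm_eq_abs,
      abs_neg, abs_of_pos hD, abs_of_nonneg (by linarith : 0 ≤ η - -D)]
    ring
  · rw [dist_eq_norm, zero_sub, norm_neg, norm_smul, he, Real.norm_eq_abs, abs_neg, abs_of_pos hD, mul_one]
  · rw [dist_eq_norm, sub_zero, norm_smul, he, Real.norm_eq_abs, abs_of_nonneg hη, mul_one]

/-- ★★★ **THE ENCLOSURE LEMMA (PROVED; pure metric — the «kinematic lemma» of row 1322 (ii))**: an atom `x` with a candidate site `c` such that EVERY unit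
direction `u` carries EITHER a soft datum towards `u` in the `κ`-cone (`dist x c′ ≤ dist c c′ + ηA`) OR a rigid datum towards `−u` in the `κ`-cone at
distance `≥ Dm` (`dist c c′ − ηB ≤ dist x c′`) TOGETHER WITH a soft datum towards `u` in the WIDE `κ₂`-cone (coarse localisation `dist x c ≤ ηA/κ₂ ≤ D₀`,
no frame continuation), lies within `d` of `c` as soon as `ηA ≤ κd`, `ηA ≤ κ₂D₀`, `D₀ < 2κDm`, `ηB ≤ Dm ∧ κd`, `ηB(2Dm − ηB) ≤ d(2κDm − D₀)`.
Used at `u := (c − x)/‖c − x‖`. [this file, g75] -/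
theorem dist_le_of_enclosed {κ κ₂ Dm D₀ d ηA ηB : ℝ} {C : Set E3} {x c : E3}
    (hκ₀ : 0 < κ) (hκ₁ : κ ≤ 1) (hκ₂ : 0 < κ₂) (hκ₂₁ : κ₂ ≤ 1) (hηA : 0 ≤ ηA) (hA : ηA ≤ κ * d) (hA₂ : ηA ≤ κ₂ * D₀)
    (hgap : D₀ < 2 * κ * Dm) (hBη : ηB ≤ Dm) (hBκ : ηB ≤ κ * d) (hB : ηB * (2 * Dm - ηB) ≤ d * (2 * κ * Dm - D₀))
    (hdata : ∀ u : E3, ‖u‖ = 1 →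
      (∃ c' ∈ C, κ * ‖c' - c‖ ≤ ⟪c' - c, u⟫_ℝ ∧ dist x c' ≤ dist c c' + ηA) ∨
      ((∃ c' ∈ C, κ * ‖c' - c‖ ≤ ⟪c' - c, -u⟫_ℝ ∧ Dm ≤ dist c c' ∧ dist c c' - ηB ≤ dist x c') ∧
        ∃ c' ∈ C, κ₂ * ‖c' - c‖ ≤ ⟪c' - c, u⟫_ℝ ∧ dist x c' ≤ dist c c' + ηA)) :
    dist x c ≤ d := by
  have hκd : 0 ≤ κ * d := hηA.trans hA
  have hd : 0 ≤ d := nonneg_of_mul_nonneg_right hκd hκ₀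
  by_cases hv : x = c
  · rw [hv, dist_self]; exact hd
  have hcx : 0 < ‖c - x‖ := by rw [norm_pos_iff, sub_ne_zero]; exact Ne.symm hv
  set u : E3 := (‖c - x‖)⁻¹ • (c - x) with hu
  have hu1 : ‖u‖ = 1 := by rw [hu, norm_smul, norm_inv, norm_norm, inv_mul_cancel₀ hcx.ne']
  have hscale : ∀ w : E3, ‖c - x‖ * ⟪w, u⟫_ℝ = ⟪w, c - x⟫_ℝ := fun w => by
    rw [hu, inner_smul_right, ← mul_assoc, mul_inv_cancel₀ hcx.ne', one_mul]
  have hbehind : ∀ {κ' : ℝ} {c' : E3}, κ' ≤ 1 → κ' * ‖c' - c‖ ≤ ⟪c' - c, u⟫_ℝ → dist x c' ≤ dist c c' + ηA → κ' * dist x c ≤ ηA :=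
    fun {κ'} {c'} hκ' hdir hup => by
      have hdir' : κ' * ‖c' - c‖ * ‖c - x‖ ≤ ⟪c' - c, c - x⟫_ℝ := by
        have := mul_le_mul_of_nonneg_right hdir hcx.le
        rwa [mul_comm ⟪c' - c, u⟫_ℝ, hscale] at this
      exact mul_dist_le_of_behind hκ' hdir' hup
  rcases hdata u hu1 with ⟨c', -, hdir, hup⟩ | ⟨⟨c', -, hdir, hDm, hlow⟩, c'', -, hdir'', hup''⟩
  · -- version A: soft datum behind
    exact le_of_mul_le_mul_left ((hbehind hκ₁ hdir hup).trans hA) hκ₀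
  · -- coarse localisation from the wide soft datum, then version B: rigid datum in front
    have hxc : dist x c ≤ D₀ := le_of_mul_le_mul_left ((hbehind hκ₂₁ hdir'' hup'').trans hA₂) hκ₂
    have hdir' : κ * ‖c' - c‖ * ‖x - c‖ ≤ ⟪c' - c, x - c⟫_ℝ := by
      have := mul_le_mul_of_nonneg_right hdir hcx.le
      rw [mul_comm ⟪c' - c, -u⟫_ℝ, inner_neg_right, mul_neg, hscale, ← inner_neg_right, neg_sub] at this
      rwa [norm_sub_rev c x] at this
    have hprod := mul_dist_le_of_front hdir' (hBη.trans hDm) hxc hlow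
    by_contra hlt
    push Not at hlt
    have hpos : 0 < 2 * κ * dist c c' - D₀ := by nlinarith
    nlinarith [mul_lt_mul_of_pos_right hlt hpos, mul_nonneg (sub_nonneg.2 hBκ) (sub_nonneg.2 hDm)]

end Trilateration

end Summit.AtomisticToContinuum.Crystallization.Theorems.ChartedZeroExcessLayeredLatticeLiouville

end
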